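import Literature.NumberTheory.Automorphic.UnboundedDenominatorsSerreBergerProofs

/-!
# The unbounded denominators theorem (Calegari–Dimitrov–Tang) — §4.4: the Borel factor of Lemma 4.4.4 from Lemma 4.6.3, and Theorem 4.3.1 from the two classical inputs

Sixth sibling of `Literature/NumberTheory/Automorphic/UnboundedDenominators.lean`; sequel of
`UnboundedDenominatorsLeveragingProofs.lean` ((4.4.9), Theorem 4.3.1 ⟸ Lemma 4.4.4) and
`UnboundedDenominatorsSerreBergerProofs.lean` (Lemma 4.4.1 ⟸ the congruence-kernel sentence
`hker`; Theorem 4.3.1 ⟸ `hker` + torus statement). Sorry-free theorems only; NO definition, NO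
named fact (D-0026). Source: F. Calegari, V. Dimitrov, Y. Tang, *The unbounded denominators
conjecture*, J. Amer. Math. Soc. **38** (2025), 627–702 = arXiv:2109.09040v4, §4.4–4.6 (published
numbering).

## What is proved

* `forall_exists_conjGL_mem_Gamma_of_ker_congruence_of_ihara` — the TORUS STATEMENT (the Borel
  factor of Lemma 4.4.4: `W = G ∩ A⁻¹GA ∩ Γ(N) ∩ Γ₀(p)` represents every class of
  `Γ(N) ∩ Γ₀(p)` mod `Γ(p)`) from `hker` (amalgam + CSP, as in the Serre–Berger file) and CDT's
  **Lemma 4.6.3 in hypothesis form** `hIhara` (for finite abelian `Q` and `ψ, φ : Γ(N) → Q` with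
  `ψ x = φ (A x A⁻¹)` on `Γ(N) ∩ Γ₁(p)`, both kernels are congruence). The proof is the character
  argument of CDT's proof of Lemma 4.4.4 (Goursat for `S × S` versus `B/U`, "by Nakayama… maps to
  `𝐅_q`", duality), run directly on `D/W ≅ S × S` with the finite abelian quotient `𝔽_pˣ/δ(W)` in
  place of the `𝐅_q`'s — so that `hIhara` is used once, with `Q = 𝔽_pˣ/δ(W)`.
* `exists_congruence_modularForm_of_slash_diag_invariant_of_ker_congruence_of_ihara` —
  **Theorem 4.3.1 from the two inputs `hker`, `hIhara`**: for `G` normal of finite index with all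
  conjugates of `Tᴺ`, `p ∤ N` prime, `A = diag(p, 1)`, a weight-`k` modular form `f` on `G` whose
  `f ∣ₖ A = p^{k-1} f(pτ)` is invariant under `G ∩ Γ(N p)` is congruence-modular.

After this file, §4 of CDT enters the proof of Theorem 1.0.1 only through: `hker` (Serre's
amalgam `SL₂(ℤ[1/p]) ⊇ Γ̃(N) = Γ(N) ⋆ A⁻¹Γ(N)A` [Ser80 II.1.4, Tho89 Thm 3, Ber94 p. 919] + the
congruence subgroup property [Men67, Ser70]); `hIhara` = Lemma 4.6.3, itself Lemma 4.6.2 (the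
abelian case of the same amalgam/CSP argument) + Corollary 4.5.3 of Theorem 4.5.2
(`H̃¹(𝐅_ℓ)^{SL₂(ℤ̂)} = 0`, group cohomology of `SL₂(ℤ)`); and the field theory of `R_N`, `M_N`
(Definition 4.2.1, Lemma 4.2.3, Theorem 4.3.2, (4.3.3)), not yet in the tree.

## References

* [CalegariDimitrovTang2025] F. Calegari, V. Dimitrov, Y. Tang, The unbounded denominators
  conjecture, J. Amer. Math. Soc. 38 (2025), 627–702; arXiv:2109.09040. §4.4 (Lemma 4.4.4 and its
  proof, Remark 4.4.8), §4.5 (Theorem 4.5.2, Corollary 4.5.3), §4.6 (Lemmas 4.6.2, 4.6.3).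
-/

noncomputable section

namespace Literature.NumberTheory.Automorphic

open scoped MatrixGroups ModularForm
open CongruenceSubgroup Matrix.SpecialLinearGroup ModularGroup

variable {G : Subgroup SL(2, ℤ)} {N p : ℕ} {A : GL (Fin 2) ℝ}

/-! ### Bookkeeping (private copies of the sibling files' helpers) -/

/-- Membership in `Γ(M)` as four divisibilities. [folklore] -/
private lemma mem_Gamma_iff_dvd₁ {M : ℕ} {γ : SL(2, ℤ)} :
    γ ∈ Gamma M ↔ (M : ℤ) ∣ γ 0 0 - 1 ∧ (M : ℤ) ∣ γ 0 1 ∧ (M : ℤ) ∣ γ 1 0 ∧ (M : ℤ) ∣ γ 1 1 - 1 := by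
  rw [Gamma_mem]
  have h1 : ∀ x : ℤ, (x : ZMod M) = 1 ↔ (M : ℤ) ∣ x - 1 := fun x ↦ by
    rw [← ZMod.intCast_zmod_eq_zero_iff_dvd, Int.cast_sub, Int.cast_one, sub_eq_zero]
  simp only [h1, ZMod.intCast_zmod_eq_zero_iff_dvd]

/-- With all conjugates of `Tᴺ` in `G`: `T^{N k} ∈ G ∩ Γ(N)`. [folklore] -/
private lemma T_zpow_mem_inf (hT : ∀ g : SL(2, ℤ), g * T ^ N * g⁻¹ ∈ G) (k : ℤ) :
    T ^ ((N : ℤ) * k) ∈ G ⊓ Gamma N := by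
  refine Subgroup.mem_inf.mpr ⟨?_, ?_⟩
  · rw [zpow_mul, zpow_natCast]
    exact Subgroup.zpow_mem _ (by simpa using hT 1) k
  · exact ModularGroup_T_pow_mem_Gamma N _ (dvd_mul_right _ _)

/-- `p ∤ N` in `ZMod p` form. [folklore] -/
private lemma natCast_ne_zero_of_coprime (hp : p.Prime) (hNp : N.Coprime p) :
    (N : ZMod p) ≠ 0 := by
  rw [Ne, ZMod.natCast_eq_zero_iff]
  intro h
  have := Nat.Coprime.eq_one_of_dvd (Nat.Coprime.symm hNp) h
  exact hp.one_lt.ne' this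

/-- The `GL₂(ℝ)` bookkeeping for `A = diag(p, 1)`: `A y = x A` as soon as `y₀₀ = x₀₀`,
`p y₀₁ = x₀₁`, `y₁₀ = p x₁₀`, `y₁₁ = x₁₁` (i.e. `y = A⁻¹ x A`). [folklore] -/
private lemma diag_mul_mapGL_eq₁ {y x : SL(2, ℤ)} {A : GL (Fin 2) ℝ} {p : ℕ}
    (hA : (A : Matrix (Fin 2) (Fin 2) ℝ) = !![(p : ℝ), 0; 0, 1])
    (h00 : y 0 0 = x 0 0) (h01 : (p : ℤ) * y 0 1 = x 0 1) (h10 : y 1 0 = p * x 1 0)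
    (h11 : y 1 1 = x 1 1) :
    A * mapGL ℝ y = mapGL ℝ x * A := by
  have r00 : ((y 0 0 : ℤ) : ℝ) = x 0 0 := by exact_mod_cast h00
  have r01 : (p : ℝ) * y 0 1 = x 0 1 := by exact_mod_cast h01
  have r10 : ((y 1 0 : ℤ) : ℝ) = p * x 1 0 := by exact_mod_cast h10
  have r11 : ((y 1 1 : ℤ) : ℝ) = x 1 1 := by exact_mod_cast h11
  apply Units.ext
  simp only [Units.val_mul, mapGL, MonoidHom.coe_comp, Function.comp_apply, coe_GL_coe_matrix,
    map_apply_coe, RingHom.mapMatrix_apply, hA]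
  ext i j
  fin_cases i <;> fin_cases j <;>
    simp only [Matrix.mul_apply, Fin.sum_univ_two, Matrix.map_apply, Matrix.of_apply,
      Matrix.cons_val', Matrix.cons_val_zero, Matrix.cons_val_one, Matrix.cons_val_fin_one,
      Matrix.empty_val', eq_intCast, Fin.zero_eta, Fin.mk_one, Fin.isValue]
  · linear_combination (p : ℝ) * r00
  · linear_combination r01
  · linear_combination r10
  · linear_combination r11

/-- `A (Γ(N) ∩ Γ₀(p)) A⁻¹ ⊆ Γ(N) ∩ Γ⁰(p)` for `A = diag(p, 1)`, `N`, `p` coprime: for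
`x ∈ Γ(N) ∩ Γ₀(p)` there is `y ∈ Γ(N)` with `p ∣ y₀₁` and `A x = y A` (`y = A x A⁻¹ =
[x₀₀, p x₀₁; x₁₀/p, x₁₁]`). [folklore] -/
private lemma exists_mem_Gamma_diag_conj (hNp : N.Coprime p)
    (hA : (A : Matrix (Fin 2) (Fin 2) ℝ) = !![(p : ℝ), 0; 0, 1]) {x : SL(2, ℤ)}
    (hx : x ∈ Gamma N ⊓ Gamma0 p) :
    ∃ y ∈ Gamma N, (p : ℤ) ∣ y 0 1 ∧ A * mapGL ℝ x = mapGL ℝ y * A := by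
  obtain ⟨h00, h01, h10, h11⟩ := mem_Gamma_iff_dvd₁.mp hx.1
  obtain ⟨c, hc⟩ : (p : ℤ) ∣ x 1 0 := (ZMod.intCast_zmod_eq_zero_iff_dvd _ _).mp hx.2
  have hdet : x 0 0 * x 1 1 - x 0 1 * x 1 0 = 1 := by
    have := Matrix.det_fin_two (x : Matrix (Fin 2) (Fin 2) ℤ)
    rw [x.det_coe] at this
    exact this.symm
  let y : SL(2, ℤ) := ⟨!![x 0 0, p * x 0 1; c, x 1 1], by
    rw [Matrix.det_fin_two_of]; linear_combination hdet + x 0 1 * hc⟩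
  have hcop : IsCoprime (N : ℤ) (p : ℤ) := Nat.isCoprime_iff_coprime.mpr hNp
  refine ⟨y, ?_, ⟨x 0 1, rfl⟩, diag_mul_mapGL_eq₁ (y := x) (x := y) hA rfl rfl hc rfl⟩
  refine mem_Gamma_iff_dvd₁.mpr ⟨?_, ?_, ?_, ?_⟩ <;>
    simp only [y, Matrix.of_apply, Matrix.cons_val', Matrix.cons_val_zero, Matrix.cons_val_one,
      Matrix.cons_val_fin_one, Matrix.empty_val']
  · exact h00
  · exact h01.mul_left _
  · rw [hc] at h10
    exact hcop.dvd_of_dvd_mul_left h10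
  · exact h11

/-- `Tⁿ ∈ A⁻¹ G A ∩ SL₂(ℤ)` when `T^{n p} ∈ G` (`A Tⁿ A⁻¹ = T^{np}` for `A = diag(p, 1)`). [folklore] -/
private lemma T_zpow_mem_conjGL (hA : (A : Matrix (Fin 2) (Fin 2) ℝ) = !![(p : ℝ), 0; 0, 1])
    {n : ℤ} (hn : T ^ (n * p) ∈ G) : T ^ n ∈ conjGL G A := by
  refine mem_conjGL.mpr ⟨T ^ (n * p), hn, ?_⟩
  have h : A * mapGL ℝ (T ^ n) = mapGL ℝ (T ^ (n * p)) * A := by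
    refine diag_mul_mapGL_eq₁ hA ?_ ?_ ?_ ?_ <;> simp [coe_T_zpow, mul_comm]
  exact (eq_mul_inv_iff_mul_eq.mpr h.symm : mapGL ℝ (T ^ (n * p)) = A * mapGL ℝ (T ^ n) * A⁻¹)

/-! ### The torus statement -/

/-- **The Borel factor of CDT Lemma 4.4.4 from Lemma 4.6.3 (hypothesis form)**
[cite: CalegariDimitrovTang2025, Lemma 4.4.4 (proof) and Lemma 4.6.3]. Setting of
`forall_exists_mul_inv_mem_and_diag_conj_of_ker_congruence` (`G` normal of finite index with all
conjugates of `Tᴺ`, `p ∤ N` prime, `A = diag(p, 1)`, the congruence-kernel sentence `hker`), and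
ASSUME CDT Lemma 4.6.3 ("Ihara's Lemma, enhanced", with the `ℚ/ℤ`-remark after Theorem 4.5.2,
i.e. for every finite abelian coefficient group `Q`) in hypothesis form `hIhara`: for homomorphisms
`ψ, φ : Γ(N) → Q` with `ψ x = φ (A x A⁻¹)` for all `x ∈ Γ(N) ∩ Γ₁(p)`, both `ψ` and `φ` have a
congruence kernel (`⊇ Γ(M) ∩ Γ(N)`, `M ≠ 0`). THEN the torus statement holds: every class of
`Γ(N) ∩ Γ₀(p)` mod `Γ(p)` (i.e. every element of the Borel `B ⊂ SL₂(𝔽_p)`) has a representative in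
`W = G ∩ A⁻¹ G A ∩ Γ(N) ∩ Γ₀(p) = ker f₁ ∩ ker f₂`. Proof (the character argument of CDT's proof of
Lemma 4.4.4, run directly on `D/W ≅ S × S`, which Lemma 4.4.1 provides): let `δ : D → 𝔽_pˣ`,
`x ↦ x₁₁ mod p` (Mathlib `Gamma0Map`), `H' = δ(W)`, `β : D → Q := 𝔽_pˣ/H'`; `β` kills `W`, so
`β = ψ ∘ f₁ · φ' ∘ f₂`-wise: `β x = ψ x · φ' (A x A⁻¹)` with `ψ k = β x_k`, `(f₁, f₂) x_k = (f k, 1)`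
and `φ'` symmetric; on `Γ(N) ∩ Γ₁(p)`, `δ = 1`, so `ψ x = φ' (A x A⁻¹)⁻¹`; by `hIhara` the kernels of
`ψ`, `φ'⁻¹` are congruence subgroups containing `G ∩ Γ(N) ∋ g Tᴺ g⁻¹`, hence `Γ(N)` (Wohlfahrt): `ψ`,
`φ'` are trivial, `β = 1`, `δ(D) ⊆ δ(W)`; finally a power of `Tᴺ ∈ W` adjusts the unipotent part. -/
theorem forall_exists_conjGL_mem_Gamma_of_ker_congruence_of_ihara [G.Normal] [G.FiniteIndex]
    (hT : ∀ g : SL(2, ℤ), g * T ^ N * g⁻¹ ∈ G) (hp : p.Prime) (hNp : N.Coprime p)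
    (hA : (A : Matrix (Fin 2) (Fin 2) ℝ) = !![(p : ℝ), 0; 0, 1])
    (hker : ∀ (Δ : Type) [Group Δ] [Finite Δ] (g₁ g₂ : Gamma N →* Δ),
      (∀ (x : SL(2, ℤ)) (hx : x ∈ Gamma N), x ∈ Gamma0 p → ∀ (y : SL(2, ℤ)) (hy : y ∈ Gamma N),
        A * mapGL ℝ x = mapGL ℝ y * A → g₁ ⟨x, hx⟩ = g₂ ⟨y, hy⟩) →
      ∃ M : ℕ, M ≠ 0 ∧ ∀ (x : SL(2, ℤ)) (hx : x ∈ Gamma N), x ∈ Gamma M → g₁ ⟨x, hx⟩ = 1)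
    (hIhara : ∀ (Q : Type) [CommGroup Q] [Finite Q] (ψ φ : Gamma N →* Q),
      (∀ (x : SL(2, ℤ)) (hx : x ∈ Gamma N), x ∈ Gamma1 p → ∀ (y : SL(2, ℤ)) (hy : y ∈ Gamma N),
        A * mapGL ℝ x = mapGL ℝ y * A → ψ ⟨x, hx⟩ = φ ⟨y, hy⟩) →
      (∃ M : ℕ, M ≠ 0 ∧ ∀ (x : SL(2, ℤ)) (hx : x ∈ Gamma N), x ∈ Gamma M → ψ ⟨x, hx⟩ = 1) ∧
      (∃ M : ℕ, M ≠ 0 ∧ ∀ (x : SL(2, ℤ)) (hx : x ∈ Gamma N), x ∈ Gamma M → φ ⟨x, hx⟩ = 1)) :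
    ∀ z ∈ Gamma N ⊓ Gamma0 p, ∃ w ∈ Gamma N ⊓ Gamma0 p,
      w ∈ G ∧ w ∈ conjGL G A ∧ w * z⁻¹ ∈ Gamma p := by
  classical
  haveI : Fact p.Prime := ⟨hp⟩
  haveI : NeZero N := ⟨fun h ↦ by
    rw [h, Nat.coprime_zero_left] at hNp
    exact hp.one_lt.ne' hNp⟩
  -- setup as in Lemma 4.4.1: `K = Γ(N) ⊇ D`, `f : K → S = K/(G ∩ K)`, `c = A · A⁻¹ : D → K`
  set K : Subgroup SL(2, ℤ) := Gamma N with hK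
  set D : Subgroup SL(2, ℤ) := Gamma N ⊓ Gamma0 p with hD
  have hDK : D ≤ K := inf_le_left
  let GK : Subgroup K := G.subgroupOf K
  haveI : GK.Normal := Subgroup.normal_subgroupOf
  let f : K →* K ⧸ GK := QuotientGroup.mk' GK
  have hfeq : ∀ a b : K, f a = f b ↔ (a : SL(2, ℤ)) * (b : SL(2, ℤ))⁻¹ ∈ G := fun a b ↦ by
    rw [QuotientGroup.mk'_apply, QuotientGroup.mk'_apply, QuotientGroup.eq_iff_div_mem,
      Subgroup.mem_subgroupOf, div_eq_mul_inv]
    rfl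
  have hf1 : ∀ a : K, f a = 1 ↔ (a : SL(2, ℤ)) ∈ G := fun a ↦ by
    rw [← map_one f, hfeq]; simp
  have hconj : ∀ x : D, ∃ y : K, (p : ℤ) ∣ (y : SL(2, ℤ)) 0 1 ∧
      A * mapGL ℝ (x : SL(2, ℤ)) = mapGL ℝ (y : SL(2, ℤ)) * A := fun x ↦ by
    obtain ⟨y, hy, hpy, he⟩ := exists_mem_Gamma_diag_conj hNp hA x.2
    exact ⟨⟨y, hy⟩, hpy, he⟩
  choose cf hcf_dvd hcf using hconj
  have hinj : ∀ y y' : SL(2, ℤ), mapGL ℝ y = mapGL ℝ y' → y = y' := fun y y' h ↦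
    mapGL_injective h
  let c : D →* K :=
    { toFun := cf
      map_one' := by
        apply Subtype.ext
        apply hinj
        have h := hcf 1
        rw [OneMemClass.coe_one, map_one, mul_one] at h
        rw [OneMemClass.coe_one, map_one]
        exact mul_right_cancel (h.symm.trans (one_mul A).symm)
      map_mul' := fun a b ↦ by
        apply Subtype.ext
        apply hinj
        have hab := hcf (a * b)
        have ha := hcf a
        have hb := hcf b
        rw [Subgroup.coe_mul, map_mul]
        rw [Subgroup.coe_mul, map_mul, ← mul_assoc, ha, mul_assoc, hb, ← mul_assoc] at hab
        exact (mul_left_injective A hab).symm ▸ rfl }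
  have hc : ∀ x : D, A * mapGL ℝ (x : SL(2, ℤ)) = mapGL ℝ ((c x : K) : SL(2, ℤ)) * A := hcf
  have hcmem : ∀ x : D, (x : SL(2, ℤ)) ∈ conjGL G A ↔ ((c x : K) : SL(2, ℤ)) ∈ G := fun x ↦ by
    rw [mem_conjGL]
    constructor
    · rintro ⟨y, hy, hyx⟩
      have : y = ((c x : K) : SL(2, ℤ)) :=
        hinj _ _ (mul_left_injective A ((eq_mul_inv_iff_mul_eq.mp hyx).trans (hc x)))
      exact this ▸ hy
    · exact fun h ↦ ⟨_, h, (eq_mul_inv_iff_mul_eq.mpr (hc x).symm)⟩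
  let f₁ : D →* K ⧸ GK := f.comp (Subgroup.inclusion hDK)
  let f₂ : D →* K ⧸ GK := f.comp c
  -- Lemma 4.4.1: `(f₁, f₂)` is onto
  have h441 := forall_exists_mul_inv_mem_and_diag_conj_of_ker_congruence hT hp hNp hA hker
  have hsurj : ∀ k₁ k₂ : K, ∃ x : D, f₁ x = f k₁ ∧ f₂ x = f k₂ := by
    intro k₁ k₂
    obtain ⟨x, hxD, h1, y, hy, h2, hAx⟩ := h441 k₁ k₁.2 k₂ k₂.2
    refine ⟨⟨x, hxD⟩, (hfeq _ _).mpr h1, (hfeq _ _).mpr ?_⟩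
    have : ((c ⟨x, hxD⟩ : K) : SL(2, ℤ)) = y :=
      hinj _ _ (mul_left_injective A ((hc ⟨x, hxD⟩).symm.trans hAx))
    rw [this]
    exact h2
  -- the kernel `W = ker f₁ ∩ ker f₂ = G ∩ A⁻¹GA ∩ D`, the character `δ : D → 𝔽_pˣ`, `x ↦ x₁₁`,
  -- and `β : D → Q = 𝔽_pˣ / δ(W)`
  let W : Subgroup D := (f₁.prod f₂).ker
  have hW : ∀ x : D, x ∈ W ↔ f₁ x = 1 ∧ f₂ x = 1 := fun x ↦ by
    rw [MonoidHom.mem_ker, MonoidHom.prod_apply, Prod.mk_eq_one]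
  let δ : D →* (ZMod p)ˣ := ((Gamma0Map p).comp (Subgroup.inclusion inf_le_right)).toHomUnits
  have hδ : ∀ x : D, ((δ x : (ZMod p)ˣ) : ZMod p) = (((x : SL(2, ℤ)) 1 1 : ℤ) : ZMod p) :=
    fun x ↦ rfl
  let H' : Subgroup (ZMod p)ˣ := W.map δ
  let β : D →* (ZMod p)ˣ ⧸ H' := (QuotientGroup.mk' H').comp δ
  have hβW : ∀ x : D, x ∈ W → β x = 1 := fun x hx ↦ by
    change ((δ x : (ZMod p)ˣ) : (ZMod p)ˣ ⧸ H') = 1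
    rw [QuotientGroup.eq_one_iff]
    exact ⟨x, hx, rfl⟩
  have hβeq : ∀ x x' : D, f₁ x = f₁ x' → f₂ x = f₂ x' → β x = β x' := by
    intro x x' h1 h2
    rw [← mul_inv_eq_one, ← map_inv, ← map_mul]
    apply hβW
    rw [hW, map_mul, map_inv, h1, mul_inv_cancel, map_mul, map_inv, h2, mul_inv_cancel]
    exact ⟨rfl, rfl⟩
  -- `ψ = α₁ ∘ f`, `φ' = α₂ ∘ f` where `β = α ∘ (f₁, f₂)`, `α = α₁ · α₂`
  choose xψ hxψ₀ using fun k : K ↦ hsurj k 1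
  choose xφ hxφ₀ using fun k : K ↦ hsurj 1 k
  have hxψ : ∀ k : K, f₁ (xψ k) = f k ∧ f₂ (xψ k) = 1 := fun k ↦ by
    simpa only [map_one] using hxψ₀ k
  have hxφ : ∀ k : K, f₁ (xφ k) = 1 ∧ f₂ (xφ k) = f k := fun k ↦ by
    simpa only [map_one] using hxφ₀ k
  let ψ : K →* (ZMod p)ˣ ⧸ H' :=
    { toFun := fun k ↦ β (xψ k)
      map_one' := hβW _ ((hW _).mpr ⟨by rw [(hxψ 1).1, map_one], (hxψ 1).2⟩)
      map_mul' := fun a b ↦ by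
        rw [← map_mul]
        apply hβeq
        · rw [(hxψ _).1, map_mul, map_mul, (hxψ a).1, (hxψ b).1]
        · rw [(hxψ _).2, map_mul, (hxψ a).2, (hxψ b).2, one_mul] }
  let φ' : K →* (ZMod p)ˣ ⧸ H' :=
    { toFun := fun k ↦ β (xφ k)
      map_one' := hβW _ ((hW _).mpr ⟨(hxφ 1).1, by rw [(hxφ 1).2, map_one]⟩)
      map_mul' := fun a b ↦ by
        rw [← map_mul]
        apply hβeq
        · rw [(hxφ _).1, map_mul, (hxφ a).1, (hxφ b).1, one_mul]
        · rw [(hxφ _).2, map_mul, map_mul, (hxφ a).2, (hxφ b).2] }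
  -- `φ = φ'⁻¹` (pointwise inverse; the target is commutative)
  let φ : K →* (ZMod p)ˣ ⧸ H' :=
    { toFun := fun k ↦ (φ' k)⁻¹
      map_one' := by rw [map_one, inv_one]
      map_mul' := fun a b ↦ by
        rw [map_mul]
        exact _root_.mul_inv (φ' a) (φ' b) }
  have hφ : ∀ k : K, φ k = (φ' k)⁻¹ := fun _ ↦ rfl
  have hψ : ∀ k : K, ψ k = β (xψ k) := fun _ ↦ rfl
  have hφ' : ∀ k : K, φ' k = β (xφ k) := fun _ ↦ rfl
  have hβ : ∀ x : D, β x = ψ (Subgroup.inclusion hDK x) * φ' (c x) := by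
    intro x
    rw [hψ, hφ', ← map_mul]
    apply hβeq
    · rw [map_mul, (hxψ _).1, (hxφ _).1, mul_one]
      rfl
    · rw [map_mul, (hxψ _).2, (hxφ _).2, one_mul]
      rfl
  -- apply Lemma 4.6.3 to `ψ` and `φ = φ'⁻¹`
  have hagree : ∀ (x : SL(2, ℤ)) (hx : x ∈ Gamma N), x ∈ Gamma1 p →
      ∀ (y : SL(2, ℤ)) (hy : y ∈ Gamma N),
      A * mapGL ℝ x = mapGL ℝ y * A → ψ ⟨x, hx⟩ = φ ⟨y, hy⟩ := by
    intro x hx hx1 y hy hxy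
    have hxD : x ∈ D := Subgroup.mem_inf.mpr ⟨hx, Gamma1_in_Gamma0 p hx1⟩
    have hyc : (⟨y, hy⟩ : K) = c ⟨x, hxD⟩ := by
      apply Subtype.ext
      apply hinj
      exact mul_left_injective A (hxy.symm.trans (hc ⟨x, hxD⟩))
    have hxK : (⟨x, hx⟩ : K) = Subgroup.inclusion hDK ⟨x, hxD⟩ := rfl
    rw [hφ, eq_inv_iff_mul_eq_one, hyc, hxK, ← hβ ⟨x, hxD⟩]
    change ((δ ⟨x, hxD⟩ : (ZMod p)ˣ) : (ZMod p)ˣ ⧸ H') = 1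
    have hδ1 : δ ⟨x, hxD⟩ = 1 := by
      apply Units.ext
      rw [hδ, Units.val_one]
      exact ((Gamma1_mem p x).mp hx1).2.1
    rw [hδ1, QuotientGroup.mk_one]
  obtain ⟨⟨Mψ, hMψ, hkψ⟩, ⟨Mφ, hMφ, hkφ⟩⟩ := hIhara ((ZMod p)ˣ ⧸ H') ψ φ hagree
  -- `ψ` and `φ'` kill `G ∩ Γ(N)`, so (Wohlfahrt) they are trivial
  have htriv : ∀ (χ : K →* (ZMod p)ˣ ⧸ H'), (∀ k : K, (k : SL(2, ℤ)) ∈ G → χ k = 1) →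
      (∃ M : ℕ, M ≠ 0 ∧ ∀ (x : SL(2, ℤ)) (hx : x ∈ Gamma N), x ∈ Gamma M → χ ⟨x, hx⟩ = 1) →
      ∀ k : K, χ k = 1 := by
    intro χ hχG ⟨M, hM, hχM⟩
    let Kχ : Subgroup SL(2, ℤ) := (χ.ker).map K.subtype
    have hKχ : ∀ (x : SL(2, ℤ)) (hx : x ∈ Gamma N), χ ⟨x, hx⟩ = 1 → x ∈ Kχ := fun x hx h ↦
      ⟨⟨x, hx⟩, h, rfl⟩
    have hcong : IsCongruenceSubgroup Kχ := by
      refine ⟨M * N, mul_ne_zero hM (NeZero.ne N), fun x hx ↦ ?_⟩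
      have hxN : x ∈ Gamma N := Wohlfahrt.Gamma_le_Gamma_of_dvd (dvd_mul_left N M) hx
      have hxM : x ∈ Gamma M := Wohlfahrt.Gamma_le_Gamma_of_dvd (dvd_mul_right M N) hx
      exact hKχ x hxN (hχM x hxN hxM)
    have hTK : ∀ g : SL(2, ℤ), g * T ^ N * g⁻¹ ∈ Kχ := by
      intro g
      have hN' : g * T ^ N * g⁻¹ ∈ Gamma N :=
        (Gamma_normal N).conj_mem _ (by simpa using ModularGroup_T_pow_mem_Gamma N N dvd_rfl) g
      exact hKχ _ hN' (hχG ⟨_, hN'⟩ (hT g))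
    have hle : Gamma N ≤ Kχ :=
      Wohlfahrt.Gamma_le_of_isCongruenceSubgroup_of_forall_conj_T_pow_mem hcong hTK
    intro k
    obtain ⟨k', hk', hk'eq⟩ := hle k.2
    have hk'' : χ k' = 1 := hk'
    have : k' = k := Subtype.ext hk'eq
    rwa [this] at hk''
  have hψG : ∀ k : K, (k : SL(2, ℤ)) ∈ G → ψ k = 1 := fun k hk ↦
    hβW _ ((hW _).mpr ⟨by rw [(hxψ k).1, hf1]; exact hk, (hxψ k).2⟩)
  have hφG : ∀ k : K, (k : SL(2, ℤ)) ∈ G → φ k = 1 := fun k hk ↦ by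
    rw [hφ, inv_eq_one]
    exact hβW _ ((hW _).mpr ⟨(hxφ k).1, by rw [(hxφ k).2, hf1]; exact hk⟩)
  have hψ1 := htriv ψ hψG ⟨Mψ, hMψ, hkψ⟩
  have hφ1 : ∀ k : K, φ' k = 1 := fun k ↦ by
    have := htriv φ hφG ⟨Mφ, hMφ, hkφ⟩ k
    rwa [hφ, inv_eq_one] at this
  -- hence `β = 1` on `D`: `δ(D) ⊆ δ(W)`
  have hδW : ∀ x : D, ∃ w₀ : D, w₀ ∈ W ∧ δ w₀ = δ x := by
    intro x
    have h1 : β x = 1 := by rw [hβ, hψ1, hφ1, one_mul]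
    change ((δ x : (ZMod p)ˣ) : (ZMod p)ˣ ⧸ H') = 1 at h1
    rw [QuotientGroup.eq_one_iff] at h1
    obtain ⟨w₀, hw₀, he⟩ := h1
    exact ⟨w₀, hw₀, he⟩
  -- conclusion: correct by a power of `Tᴺ ∈ W`
  intro z hz
  obtain ⟨w₀, hw₀W, hδw₀⟩ := hδW ⟨z, hz⟩
  have hN0 : (N : ZMod p) ≠ 0 := natCast_ne_zero_of_coprime hp hNp
  let v : D := w₀ * ⟨z, hz⟩⁻¹
  have hvz : (v : SL(2, ℤ)) = (w₀ : SL(2, ℤ)) * z⁻¹ := rfl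
  have hδv : δ v = 1 := by
    show δ (w₀ * ⟨z, hz⟩⁻¹) = 1
    rw [map_mul, map_inv, hδw₀, mul_inv_cancel]
  have hv11 : ((((v : SL(2, ℤ)) 1 1 : ℤ) : ZMod p)) = 1 := by
    rw [← hδ v, hδv, Units.val_one]
  have hv10 : ((((v : SL(2, ℤ)) 1 0 : ℤ) : ZMod p)) = 0 := Gamma0_mem.mp v.2.2
  have hv00 : ((((v : SL(2, ℤ)) 0 0 : ℤ) : ZMod p)) = 1 := by
    have hdet : ((((v : SL(2, ℤ)) 0 0 : ℤ) : ZMod p)) * (v : SL(2, ℤ)) 1 1 -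
        (v : SL(2, ℤ)) 0 1 * (v : SL(2, ℤ)) 1 0 = 1 := by
      have := Matrix.det_fin_two ((v : SL(2, ℤ)) : Matrix (Fin 2) (Fin 2) ℤ)
      rw [(v : SL(2, ℤ)).det_coe] at this
      exact_mod_cast congr_arg (fun t : ℤ ↦ (t : ZMod p)) this.symm
    rwa [hv11, hv10, mul_one, mul_zero, sub_zero] at hdet
  obtain ⟨m, hm⟩ := ZMod.intCast_surjective
    (((((v : SL(2, ℤ)) 0 1 : ℤ) : ZMod p)) * (N : ZMod p)⁻¹)
  have hTD : T ^ ((N : ℤ) * (-m)) ∈ D := Subgroup.mem_inf.mpr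
    ⟨(T_zpow_mem_inf hT (-m)).2, by rw [Gamma0_mem, coe_T_zpow]; simp⟩
  have hTG : T ^ ((N : ℤ) * (-m)) ∈ G := (T_zpow_mem_inf hT (-m)).1
  have hTc : T ^ ((N : ℤ) * (-m)) ∈ conjGL G A := by
    apply T_zpow_mem_conjGL hA
    rw [mul_assoc]
    exact (T_zpow_mem_inf hT (-m * p)).1
  have hw₀G : (w₀ : SL(2, ℤ)) ∈ G := (hf1 _).mp ((hW w₀).mp hw₀W).1
  have hw₀c : (w₀ : SL(2, ℤ)) ∈ conjGL G A := (hcmem w₀).mpr ((hf1 _).mp ((hW w₀).mp hw₀W).2)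
  refine ⟨T ^ ((N : ℤ) * (-m)) * w₀, mul_mem hTD w₀.2, mul_mem hTG hw₀G, mul_mem hTc hw₀c, ?_⟩
  rw [mul_assoc, ← hvz]
  have hmat : ((T ^ ((N : ℤ) * (-m)) * (v : SL(2, ℤ)) : SL(2, ℤ)) : Matrix (Fin 2) (Fin 2) ℤ) =
      !![(v : SL(2, ℤ)) 0 0 + (N : ℤ) * (-m) * (v : SL(2, ℤ)) 1 0,
        (v : SL(2, ℤ)) 0 1 + (N : ℤ) * (-m) * (v : SL(2, ℤ)) 1 1;
        (v : SL(2, ℤ)) 1 0, (v : SL(2, ℤ)) 1 1] := by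
    rw [coe_mul, coe_T_zpow]
    ext i j
    fin_cases i <;> fin_cases j <;> simp [Matrix.mul_apply, Fin.sum_univ_two]
  rw [Gamma_mem, hmat]
  simp only [Matrix.of_apply, Matrix.cons_val', Matrix.cons_val_zero, Matrix.cons_val_one,
    Matrix.cons_val_fin_one, Matrix.empty_val']
  push_cast
  rw [hv00, hv10, hv11, hm]
  refine ⟨by ring, ?_, rfl, rfl⟩
  linear_combination (-(((v : SL(2, ℤ)) 0 1 : ℤ) : ZMod p)) * mul_inv_cancel₀ hN0

/-- **CDT Theorem 4.3.1 from the two classical inputs of §4.4–4.6** [cite: CalegariDimitrovTang2025,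
Theorem 4.3.1, Lemma 4.4.1 and Lemma 4.6.3]. Let `G ≤ SL(2, ℤ)` be normal of finite index with all
conjugates of `Tᴺ`, `p` a prime not dividing `N ≠ 0`, `A = diag(p, 1)`. Assume the
congruence-kernel sentence `hker` (amalgam `SL₂(ℤ[1/p])` + congruence subgroup property) and
Lemma 4.6.3 in hypothesis form `hIhara`. If `f` is a weight-`k` modular form on `G` with
`f ∣ₖ A = p^{k-1} f(pτ)` invariant under `G ∩ Γ(N p)`, then `f` is a modular form on a congruence
subgroup — everything in between (projections, Goursat, Wohlfahrt, the character argument for the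
Borel factor, display (4.4.9), the passage `f(pτ) ↦ f`) being proved in the tree. -/
theorem exists_congruence_modularForm_of_slash_diag_invariant_of_ker_congruence_of_ihara
    [G.Normal] [G.FiniteIndex] {k : ℤ} (hT : ∀ g : SL(2, ℤ), g * T ^ N * g⁻¹ ∈ G) (hN : N ≠ 0)
    (hp : p.Prime) (hNp : N.Coprime p) (hA : (A : Matrix (Fin 2) (Fin 2) ℝ) = !![(p : ℝ), 0; 0, 1])
    (hker : ∀ (Δ : Type) [Group Δ] [Finite Δ] (g₁ g₂ : Gamma N →* Δ),
      (∀ (x : SL(2, ℤ)) (hx : x ∈ Gamma N), x ∈ Gamma0 p → ∀ (y : SL(2, ℤ)) (hy : y ∈ Gamma N),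
        A * mapGL ℝ x = mapGL ℝ y * A → g₁ ⟨x, hx⟩ = g₂ ⟨y, hy⟩) →
      ∃ M : ℕ, M ≠ 0 ∧ ∀ (x : SL(2, ℤ)) (hx : x ∈ Gamma N), x ∈ Gamma M → g₁ ⟨x, hx⟩ = 1)
    (hIhara : ∀ (Q : Type) [CommGroup Q] [Finite Q] (ψ φ : Gamma N →* Q),
      (∀ (x : SL(2, ℤ)) (hx : x ∈ Gamma N), x ∈ Gamma1 p → ∀ (y : SL(2, ℤ)) (hy : y ∈ Gamma N),
        A * mapGL ℝ x = mapGL ℝ y * A → ψ ⟨x, hx⟩ = φ ⟨y, hy⟩) →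
      (∃ M : ℕ, M ≠ 0 ∧ ∀ (x : SL(2, ℤ)) (hx : x ∈ Gamma N), x ∈ Gamma M → ψ ⟨x, hx⟩ = 1) ∧
      (∃ M : ℕ, M ≠ 0 ∧ ∀ (x : SL(2, ℤ)) (hx : x ∈ Gamma N), x ∈ Gamma M → φ ⟨x, hx⟩ = 1))
    (f : ModularForm (G : Subgroup (GL (Fin 2) ℝ)) k)
    (hinv : ∀ γ ∈ G ⊓ Gamma (N * p), (⇑f ∣[k] A) ∣[k] (mapGL ℝ γ) = ⇑f ∣[k] A) :
    ∃ (Γ' : Subgroup SL(2, ℤ)) (g : ModularForm (Γ' : Subgroup (GL (Fin 2) ℝ)) k),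
      IsCongruenceSubgroup Γ' ∧ (g : UpperHalfPlane → ℂ) = f :=
  exists_congruence_modularForm_of_slash_diag_invariant_of_ker_congruence hT hN hp hNp hA hker
    (forall_exists_conjGL_mem_Gamma_of_ker_congruence_of_ihara hT hp hNp hA hker hIhara) f hinv

end Literature.NumberTheory.Automorphic

end
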